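import Summits.HubbardSuperconductivity.HubbardSuperconductivity.Theorems.AnisotropyChordTransferFibre3GroundVariational

/-!
# Route `AnisotropyChord` / H0 rotor rung: EXISTENCE OF THE GROUND TWO-MAGNON PROFILE (`IsGroundTwoMagnon` witness, every `L ≥ 2`, every `Δ`)

The GM₃ assembly (`gm3_of_cruxes_*`, `…Fibre3KTAssembly*`, PORT PartN31) takes a ground two-magnon profile
`hf : IsGroundTwoMagnon L Δ lam2 f` as input («the IsGroundTwoMagnon witness per (L,Δ)», memo KTASSEMBLY-LEAN-g22 §3),
and the KT-2b / one-loop layers use its lattice symmetries (`f(y,x) = f(x,y)`, `f(−x,y) = f(x,y)`).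
**`exists_isGroundTwoMagnon (hL : 2 ≤ L) (Δ : ℝ) : ∃ lam2 f, IsGroundTwoMagnon L Δ lam2 f ∧ (swap-symmetric) ∧
(x-mirror-symmetric) ∧ (∀ r ≠ 0, 0 < f r)`**: take the constrained minimiser of `…Fibre3GroundVariational`
(`exists_min_sphere`), pass to its absolute value (`qf_abs_le`; positive off the origin by `pos_of_nonneg_min`),
symmetrise over `r ↦ −r`, `(x,y) ↦ (y,x)`, `(x,y) ↦ (−x,y)` (EL solutions are a linear space stable under the three
involutions), and normalise `Σ f = V`.
Prover seat `hubbard-h0-rotor-p1` g23; helper for stmt-HubbardSuperconductivity-19089 (`--supports`).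
-/

set_option linter.dupNamespace false
set_option autoImplicit false

noncomputable section

open scoped BigOperators

namespace Summit.HubbardSuperconductivity.HubbardSuperconductivity.Theorems.AnisotropyChord.Transfer.Fibre3

variable (L : ℕ) [NeZero L]

/-! ## Zeros of a nonnegative minimiser spread; the `x ↦ −x` symmetry of every ground profile -/

/-- **zeros spread:** a nonnegative constrained minimiser vanishing at one nonzero site vanishes identically (`L ≥ 2`). [folklore] -/
theorem zero_spreads (hL : 2 ≤ L) {Δ lam : ℝ} {g : Tor L → ℝ} (hg0 : ∀ r, 0 ≤ g r)
    (hmin : ∀ h : Tor L → ℝ, h 0 = 0 → lam * ∑ r : Tor L, h r ^ 2 ≤ twoMagnonQF L Δ h)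
    (hgQ : twoMagnonQF L Δ g = lam * ∑ r : Tor L, g r ^ 2) (hz : g 0 = 0)
    {a : Tor L} (ha : a ≠ 0) (hga : g a = 0) (r : Tor L) : g r = 0 := by
  have hnb : ∀ s : Tor L, s ≠ 0 → g s = 0 → nbSum L g s = 0 :=
    fun s hs hgs => nbSum_eq_zero_of_min L hg0 hmin hgQ hz hs hgs
  have hx : ∀ s : Tor L, s ≠ 0 → g s = 0 → s + ex L ≠ 0 → g (s + ex L) = 0 := by
    intro s hs hgs _
    have h' := hnb s hs hgs
    unfold nbSum at h'
    have := hg0 (s + ex L); have := hg0 (s + -ex L); have := hg0 (s + ey L); have := hg0 (s + -ey L)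
    linarith
  have hy : ∀ s : Tor L, s ≠ 0 → g s = 0 → s + ey L ≠ 0 → g (s + ey L) = 0 := by
    intro s hs hgs _
    have h' := hnb s hs hgs
    unfold nbSum at h'
    have := hg0 (s + ex L); have := hg0 (s + -ex L); have := hg0 (s + ey L); have := hg0 (s + -ey L)
    linarith
  by_cases hr : r = 0
  · rw [hr, hz]
  · exact torus_connect L hL (fun u => g u = 0) hx hy ha hr hga

/-- ★ **the ground two-magnon profile is `x`-mirror-symmetric:** `f (−x, y) = f (x, y)` (`L ≥ 2`; from minimality alone,
like `ground_swap` of `…Fibre3GradSNormClosed`: `h = f − f∘mirror` solves the EL equations and vanishes at the origin and on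
the axis point `(0,1)`). [folklore] -/
theorem ground_mirror (hL : 2 ≤ L) {Δ lam2 : ℝ} {f : Tor L → ℝ} (hf : IsGroundTwoMagnon L Δ lam2 f) (r : Tor L) :
    f (-r.1, r.2) = f r := by
  obtain ⟨htm, _, hmin⟩ := hf
  have h0 : f 0 = 0 := htm.1
  have hEL : ∀ u : Tor L, u ≠ 0 → tmOp L Δ f u = lam2 * f u := fun u hu => twoMagnon_eq_nbSum L htm u hu
  set h : Tor L → ℝ := fun u => f u + (-1) * f (-u.1, u.2) with hh
  have hELh : ∀ u : Tor L, u ≠ 0 → tmOp L Δ h u = lam2 * h u :=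
    EL_add L hEL (EL_smul L (g := fun s => f (-s.1, s.2)) (EL_comp_mirror L hEL) (-1))
  have hz : h 0 = 0 := by
    simp only [hh, Prod.fst_zero, Prod.snd_zero, neg_zero, Prod.mk_zero_zero, h0]; ring
  have hQh := qf_of_EL L hz hELh
  set g : Tor L → ℝ := fun u => |h u| with hg
  have hg0 : ∀ u, 0 ≤ g u := fun u => abs_nonneg _
  have hgz : g 0 = 0 := by simp only [hg]; rw [hz, abs_zero]
  have hQg : twoMagnonQF L Δ g = lam2 * ∑ u : Tor L, g u ^ 2 := by
    have hle := qf_abs_le L Δ h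
    have hge := hmin g hgz
    have hsq : ∑ u : Tor L, g u ^ 2 = ∑ u : Tor L, h u ^ 2 := Finset.sum_congr rfl fun u _ => sq_abs (h u)
    rw [hsq] at hge ⊢
    have hle' : twoMagnonQF L Δ g ≤ twoMagnonQF L Δ h := hle
    linarith
  -- the axis point `e_y = (0,1)` is fixed by the mirror, so `g(e_y) = 0`
  have hey : ey L ≠ 0 := (exy_ne L hL).2.1
  have hgey : g (ey L) = 0 := by
    have : ((-(ey L).1, (ey L).2) : Tor L) = ey L := by unfold ey; simp
    simp only [hg, hh]; rw [this]; ring_nf; simp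
  have key := zero_spreads L hL hg0 hmin hQg hgz hey hgey r
  have : |f r + (-1) * f (-r.1, r.2)| = 0 := key
  rw [abs_eq_zero] at this
  linarith

/-! ## The witness -/

/-- **EXISTENCE OF THE GROUND TWO-MAGNON PROFILE** (`L ≥ 2`, every real `Δ`): there are `λ₂` and `f` with
`IsGroundTwoMagnon L Δ λ₂ f`, `f(y,x) = f(x,y)`, `f(−x,y) = f(x,y)`, and `f > 0` off the origin. [folklore] -/
theorem exists_isGroundTwoMagnon (hL : 2 ≤ L) (Δ : ℝ) :
    ∃ lam2 : ℝ, ∃ f : Tor L → ℝ, IsGroundTwoMagnon L Δ lam2 f ∧ (∀ r : Tor L, f (r.2, r.1) = f r)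
      ∧ (∀ r : Tor L, f (-r.1, r.2) = f r) ∧ (∀ r : Tor L, r ≠ 0 → 0 < f r) := by
  obtain ⟨lam, f₀, hf0, hf1, hfQ, hmin⟩ := exists_min_sphere L hL Δ
  -- the nonnegative minimiser |f₀|
  set g : Tor L → ℝ := fun r => |f₀ r| with hgdef
  have hg0 : ∀ r, 0 ≤ g r := fun r => abs_nonneg _
  have hgz : g 0 = 0 := by simp [hgdef, hf0]
  have hg1 : ∑ r : Tor L, g r ^ 2 = 1 := by
    rw [← hf1]; exact Finset.sum_congr rfl fun r _ => sq_abs (f₀ r)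
  have hgQ : twoMagnonQF L Δ g = lam * ∑ r : Tor L, g r ^ 2 := by
    have hle := qf_abs_le L Δ f₀
    have hge := hmin g hgz
    rw [hg1] at hge ⊢
    rw [hfQ] at hle
    have : twoMagnonQF L Δ g = twoMagnonQF L Δ (fun r => |f₀ r|) := rfl
    linarith
  have hgpos : ∀ r : Tor L, r ≠ 0 → 0 < g r := pos_of_nonneg_min L hL hg0 hmin hgQ hgz hg1
  have hgEL : ∀ r : Tor L, r ≠ 0 → tmOp L Δ g r = lam * g r := EL_of_min L hmin hgz hgQ
  -- symmetrise: r ↦ −r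
  set g₁ : Tor L → ℝ := fun r => g r + g (-r) with hg₁
  have hg₁EL : ∀ r : Tor L, r ≠ 0 → tmOp L Δ g₁ r = lam * g₁ r := EL_add L hgEL (EL_comp_neg L hgEL)
  have hg₁z : g₁ 0 = 0 := by simp [hg₁, hgz]
  have hg₁ev : ∀ r, g₁ (-r) = g₁ r := by intro r; simp only [hg₁, neg_neg]; ring
  have hg₁pos : ∀ r : Tor L, r ≠ 0 → 0 < g₁ r := fun r hr => by
    simp only [hg₁]; exact add_pos (hgpos r hr) (hgpos (-r) (neg_ne_zero.mpr hr))
  -- symmetrise: (x,y) ↦ (y,x)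
  set g₂ : Tor L → ℝ := fun r => g₁ r + g₁ (r.2, r.1) with hg₂
  have hg₂EL : ∀ r : Tor L, r ≠ 0 → tmOp L Δ g₂ r = lam * g₂ r := EL_add L hg₁EL (EL_comp_swap L hg₁EL)
  have hg₂z : g₂ 0 = 0 := by
    simp only [hg₂, Prod.fst_zero, Prod.snd_zero, Prod.mk_zero_zero, hg₁z, add_zero]
  have hg₂ev : ∀ r, g₂ (-r) = g₂ r := by
    intro r
    simp only [hg₂, Prod.fst_neg, Prod.snd_neg]
    rw [hg₁ev, show ((-r.2, -r.1) : Tor L) = -(r.2, r.1) from rfl, hg₁ev]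
  have hg₂sw : ∀ r : Tor L, g₂ (r.2, r.1) = g₂ r := by intro r; simp only [hg₂]; ring
  have hg₂pos : ∀ r : Tor L, r ≠ 0 → 0 < g₂ r := fun r hr => by
    simp only [hg₂]
    exact add_pos (hg₁pos r hr) (hg₁pos _ (swap_ne_zero L hr))
  -- symmetrise: (x,y) ↦ (−x,y)
  set g₃ : Tor L → ℝ := fun r => g₂ r + g₂ (-r.1, r.2) with hg₃
  have hg₃EL : ∀ r : Tor L, r ≠ 0 → tmOp L Δ g₃ r = lam * g₃ r := EL_add L hg₂EL (EL_comp_mirror L hg₂EL)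
  have hg₃z : g₃ 0 = 0 := by
    simp only [hg₃, Prod.fst_zero, Prod.snd_zero, neg_zero, Prod.mk_zero_zero, hg₂z, add_zero]
  have hg₃mi : ∀ r : Tor L, g₃ (-r.1, r.2) = g₃ r := by intro r; simp only [hg₃, neg_neg]; ring
  have hg₃ev : ∀ r, g₃ (-r) = g₃ r := by
    intro r
    simp only [hg₃, Prod.fst_neg, Prod.snd_neg, neg_neg]
    rw [hg₂ev, show ((r.1, -r.2) : Tor L) = -(-r.1, r.2) by simp, hg₂ev]
  have hg₃sw : ∀ r : Tor L, g₃ (r.2, r.1) = g₃ r := by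
    intro r
    simp only [hg₃]
    rw [hg₂sw, show ((-r.2, r.1) : Tor L) = ((r.1, -r.2) : Tor L).swap from rfl, Prod.swap, hg₂sw (r.1, -r.2),
      show ((r.1, -r.2) : Tor L) = -(-r.1, r.2) by simp, hg₂ev]
  have hg₃pos : ∀ r : Tor L, r ≠ 0 → 0 < g₃ r := fun r hr => by
    simp only [hg₃]
    exact add_pos (hg₂pos r hr) (hg₂pos _ (mirror_ne_zero' L hr))
  have hg₃nn : ∀ r : Tor L, 0 ≤ g₃ r := fun r => by
    by_cases hr : r = 0
    · rw [hr, hg₃z]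
    · exact (hg₃pos r hr).le
  -- normalise Σ f = V
  have hK : K1 L ≠ 0 := K1_ne_zero L hL
  set s : ℝ := ∑ r : Tor L, g₃ r with hs
  have hspos : 0 < s :=
    lt_of_lt_of_le (hg₃pos (K1 L) hK) (Finset.single_le_sum (fun r _ => hg₃nn r) (Finset.mem_univ (K1 L)))
  have hV : (0 : ℝ) < (L : ℝ) ^ 2 := by
    have : (0 : ℝ) < L := by exact_mod_cast Nat.pos_of_ne_zero (NeZero.ne L)
    positivity
  set c : ℝ := (L : ℝ) ^ 2 / s with hc
  have hcpos : 0 < c := div_pos hV hspos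
  set f : Tor L → ℝ := fun r => c * g₃ r with hf
  have hfEL : ∀ r : Tor L, r ≠ 0 → tmOp L Δ f r = lam * f r := EL_smul L hg₃EL c
  have hfz : f 0 = 0 := by simp [hf, hg₃z]
  have hfpos : ∀ r : Tor L, r ≠ 0 → 0 < f r := fun r hr => mul_pos hcpos (hg₃pos r hr)
  have hfev : ∀ r, f (-r) = f r := fun r => by simp only [hf, hg₃ev]
  have hfsw : ∀ r : Tor L, f (r.2, r.1) = f r := fun r => by simp only [hf, hg₃sw]
  have hfmi : ∀ r : Tor L, f (-r.1, r.2) = f r := fun r => by simp only [hf, hg₃mi]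
  have hfsum : ∑ r : Tor L, f r = (L : ℝ) ^ 2 := by
    simp only [hf]; rw [← Finset.mul_sum, ← hs, hc, div_mul_cancel₀ _ hspos.ne']
  refine ⟨lam, f, ⟨⟨hfz, ?_, hfpos _ hK, hfsum, ?_⟩, hfev, hmin⟩, hfsw, hfmi, hfpos⟩
  · -- nearest-neighbour values
    intro e he
    unfold nnList at he
    simp only [List.mem_cons, List.mem_nil_iff, or_false] at he
    have hK1 : K1 L = ex L := rfl
    rcases he with h | h | h | h <;> rw [h]
    · rfl
    · rw [neg_ex, hK1, hfev]
    · rw [hK1]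
      show f (((0 : ZMod L), (1 : ZMod L))) = f (ex L)
      have := hfsw ((0 : ZMod L), (1 : ZMod L))
      exact this.symm ▸ rfl
    · rw [neg_ey, hfev, hK1]
      have := hfsw ((0 : ZMod L), (1 : ZMod L))
      exact this.symm ▸ rfl
  · -- the two-magnon equation off the origin
    intro r hr
    rw [nnList_map_sum]
    have h := hfEL r hr
    unfold tmOp nnInd nbSum at h
    linarith

/-- the plain witness: `∃ λ₂ f, IsGroundTwoMagnon L Δ λ₂ f` (`L ≥ 2`, every `Δ`). [folklore] -/
theorem exists_ground (hL : 2 ≤ L) (Δ : ℝ) : ∃ lam2 : ℝ, ∃ f : Tor L → ℝ, IsGroundTwoMagnon L Δ lam2 f := by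
  obtain ⟨lam2, f, hf, -, -, -⟩ := exists_isGroundTwoMagnon L hL Δ
  exact ⟨lam2, f, hf⟩

end Summit.HubbardSuperconductivity.HubbardSuperconductivity.Theorems.AnisotropyChord.Transfer.Fibre3

end
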